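import Mathlib
import HarnessLib
import Summits.CriticalPhenomena.PercolationContinuityZ3.Theses.PercNonProliferation
import Literature.Probability.Percolation.IntegratedRusso
import Literature.Probability.Percolation.SusceptibilityMeanFieldLower

/-!
# Sketch — crux-ideate stmt-CriticalPhenomena-4447 (PercNonProliferation.FreeBoxPowerSaving), round 1, ideator 3

First lemmas of the two crux idea cards, stated over existing declarations (they must elaborate;
nothing here is claimed proved unless a proof term is given).

* Card A `l2-gluing-defect-rg`: the free-box L² mass `S_n = Σ_{pieces} |P|²` is EXACTLY
  block-recursive (`B(3n+1)` = 27 translates of `B(n)`), so any uniform contraction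
  `FA₂(3n+1) ≤ ρ FA₂(n)`, `ρ < 1`, is a power saving; a failure of contraction (an L² stall) is to be
  converted into the high-probability gluing block event `GlueAll`, which a same-`p` finite-size
  criterion forbids at `p_c`.
* Card B `russo-merge-moment-two-ghost`: Russo's formula for `S_n` in `p` is exact; the derivative is a
  merge moment controlled by the in-box VOLUME two-ghost exponent `y`; with a polynomially-subcritical
  sparsity input at `p_c - n^{-b}` the crux follows whenever `b > 3 - 3y + a`.
-/

namespace Summit.CriticalPhenomena.PercolationContinuityZ3.Cruxes.FreeBoxPowerSaving.Ideator3

open scoped Classical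
open MeasureTheory Literature.Probability.Percolation Literature.Probability.LatticeModels

/-- Bond percolation on `ℤ³` at parameter `p`. -/
noncomputable abbrev μ (p : unitInterval) : Measure (BondConfig (Site 3)) :=
  bondPercolation (zdGraph 3) p

/-- The critical measure. -/
noncomputable abbrev μc : Measure (BondConfig (Site 3)) := μ (criticalProbI 3)

/-- `E_p S_n = Σ_{x,y ∈ B(n)} P_p(x ↔ y inside B(n))` (expected sum of squared piece sizes of the
free box). -/
noncomputable def pairSum (n : ℕ) (p : unitInterval) : ℝ :=
  ∑ x ∈ box 3 n, ∑ y ∈ box 3 n, (μ p).real (openConnIn (↑(box 3 n) : Set (Site 3)) x y)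

/-- `FA₂(n; p) = E_p S_n / |B(n)|²`. -/
noncomputable def FA2 (n : ℕ) (p : unitInterval) : ℝ :=
  pairSum n p / ((box 3 n).card : ℝ) ^ 2

/-- The crux, verbatim, is `∃ a > 0, C, ∀ n ≥ 1, FA₂(n; p_c) ≤ C n^{-a}`. -/
theorem crux_iff :
    Summit.CriticalPhenomena.PercolationContinuityZ3.Theses.PercNonProliferation.FreeBoxPowerSaving ↔
      ∃ a C : ℝ, 0 < a ∧ ∀ n : ℕ, 1 ≤ n → FA2 n (criticalProbI 3) ≤ C * (n : ℝ) ^ (-a) :=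
  Iff.rfl

/-! ## Card A — L² block renormalisation -/

/-- Shift vector of the sub-box indexed by `v ∈ {0,1,2}³` (read as `{-1,0,1}³`): `(2n+1)·(v-1)`. -/
def subShift (n : ℕ) (v : Fin 3 → Fin 3) : Site 3 :=
  fun i => (2 * (n : ℤ) + 1) * (((v i : ℕ) : ℤ) - 1)

/-- The 27 sub-boxes of `B(3n+1)` (side `6n+3 = 3(2n+1)`): translates of `B(n)`. -/
noncomputable def subBox (n : ℕ) (v : Fin 3 → Fin 3) : Finset (Site 3) :=
  (box 3 n).image fun x => x + subShift n v

/-- Size of the piece of `x` inside the finite region `Λ` (free boundary: paths inside `Λ`). -/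
noncomputable def pieceSize (Λ : Finset (Site 3)) (x : Site 3) (ω : BondConfig (Site 3)) : ℕ :=
  (Λ.filter fun z => ω ∈ openConnIn (↑Λ : Set (Site 3)) x z).card

/-- Sum of the 27 sub-box pair sums inside `B(3n+1)`. -/
noncomputable def subPairSum (n : ℕ) (p : unitInterval) : ℝ :=
  ∑ v : Fin 3 → Fin 3, ∑ x ∈ subBox n v, ∑ y ∈ subBox n v,
    (μ p).real (openConnIn (↑(subBox n v) : Set (Site 3)) x y)

/-- The cross term of the block identity: pairs of `B(3n+1)` joined inside the big box but not
inside a common sub-box. -/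
noncomputable def crossTerm (n : ℕ) (p : unitInterval) : ℝ := pairSum (3 * n + 1) p - subPairSum n p

/-- (A0, provable now) exact block identity: translation invariance makes the 27 sub-box terms equal
to `pairSum n p`, and in-box monotonicity (`openConnIn_mono`) makes the cross term non-negative;
hence `FA₂(3n+1) = FA₂(n)/27 + crossTerm/|B(3n+1)|²`. -/
def BlockIdentity : Prop :=
  ∀ (n : ℕ) (p : unitInterval), subPairSum n p = 27 * pairSum n p ∧ 0 ≤ crossTerm n p

/-- (A1, provable now) a uniform contraction per tripling is a power saving (iterate along
`n_k` with `2 n_{k+1} + 1 = 3 (2 n_k + 1)`, interpolate by box monotonicity at cost `≤ 729`). -/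
def ContractionImpliesCrux : Prop :=
  (∃ ρ : ℝ, ρ < 1 ∧ ∃ n₀ : ℕ, ∀ n : ℕ, n₀ ≤ n →
      FA2 (3 * n + 1) (criticalProbI 3) ≤ ρ * FA2 n (criticalProbI 3)) →
    Summit.CriticalPhenomena.PercolationContinuityZ3.Theses.PercNonProliferation.FreeBoxPowerSaving

/-- The gluing block event `GlueAll(n, m)`: every sub-box of `B(3n+1)` has a piece with `≥ m`
vertices, and all vertices of all such fat sub-box pieces are pairwise joined inside `B(3n+1)`. -/
def GlueAll (n m : ℕ) : Set (BondConfig (Site 3)) :=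
  {ω | (∀ v, ∃ x ∈ subBox n v, m ≤ pieceSize (subBox n v) x ω) ∧
    ∀ v w, ∀ x ∈ subBox n v, ∀ y ∈ subBox n w,
      m ≤ pieceSize (subBox n v) x ω → m ≤ pieceSize (subBox n w) y ω →
        ω ∈ openConnIn (↑(box 3 (3 * n + 1)) : Set (Site 3)) x y}

/-- (A2, provable now; the same-`p` finite-size criterion used as an UPPER bound at `p_c`) if
`P_p(GlueAll(n,m)) > 1 - ε₀` for one `(n, m)` then, by continuity in `p` of this local event,
3-dependent Liggett–Schonmann–Stacey domination of the block process indexed by `(2n+1)ℤ³`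
(overlapping big boxes share whole sub-boxes, so their fat pieces are identified) and a Peierls
count, there is an infinite open cluster at some `p < p_c` — absurd. Hence the bound below. -/
def GlueBlockCriterion : Prop :=
  ∃ ε₀ : ℝ, 0 < ε₀ ∧ ∀ n m : ℕ, 1 ≤ n → μc.real (GlueAll n m) ≤ 1 - ε₀

/-- (A3, the HARD stub — equality-case stability of the block identity across 27 i.i.d. sub-boxes) an
L² stall at scale `n` forces gluing w.h.p. at the L² piece scale `m ≍ c (E S_n)^{1/2}`. -/
def StallForcesGlue : Prop :=
  ∀ ε₀ : ℝ, 0 < ε₀ → ∃ ρ : ℝ, ρ < 1 ∧ ∃ c : ℝ, 0 < c ∧ ∃ n₀ : ℕ, ∀ n : ℕ, n₀ ≤ n →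
    ρ * FA2 n (criticalProbI 3) ≤ FA2 (3 * n + 1) (criticalProbI 3) →
      1 - ε₀ ≤ μc.real (GlueAll n ⌈c * Real.sqrt (pairSum n (criticalProbI 3))⌉₊)

/-- First lemma of Card A: the three stubs compose to the crux (pure logic). -/
theorem cardA_closure (h1 : ContractionImpliesCrux) (h2 : GlueBlockCriterion) (h3 : StallForcesGlue) :
    Summit.CriticalPhenomena.PercolationContinuityZ3.Theses.PercNonProliferation.FreeBoxPowerSaving := by
  obtain ⟨ε₀, hε₀, hcrit⟩ := h2
  obtain ⟨ρ, hρ, c, _hc, n₀, hstall⟩ := h3 (ε₀ / 2) (by positivity)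
  refine h1 ⟨ρ, hρ, max n₀ 1, fun n hn => ?_⟩
  by_contra hlt
  push_neg at hlt
  have hn0 : n₀ ≤ n := le_trans (le_max_left _ _) hn
  have hn1 : 1 ≤ n := le_trans (le_max_right _ _) hn
  have hglue := hstall n hn0 hlt.le
  have hcap := hcrit n ⌈c * Real.sqrt (pairSum n (criticalProbI 3))⌉₊ hn1
  linarith

/-! ## Card B — Russo in `p` for the L² mass, merge moment, volume two-ghost -/

/-- `E_s S_n` as a function of the real parameter `s` (constant extension `prm`). -/
noncomputable def pairSumR (n : ℕ) (s : ℝ) : ℝ := pairSum n (prm s)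

/-- The merge moment in pivotal form: `Σ_e Σ_{x,y} P_s(e pivotal for {x ↔ y in B(n)})`
(`= (2/(1-s)) E_s[Σ_{closed e joining distinct pieces P,P'} |P| |P'|]`). -/
noncomputable def mergeMomentPiv (n : ℕ) (s : ℝ) : ℝ :=
  ∑ e ∈ edgesIn (zdGraph 3) (box 3 n), ∑ x ∈ box 3 n, ∑ y ∈ box 3 n,
    pivProb 3 (openConnIn (↑(box 3 n) : Set (Site 3)) x y) e s

/-- (B0, provable now from `russo_formula_sum_holds`: each `{x ↔ y in B(n)}` is increasing and
determined by `edgesIn (zdGraph 3) (box 3 n)`) Russo's formula for the free-box L² mass,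
integrated. -/
def FreeBoxRusso : Prop :=
  ∀ (n : ℕ) (p q : ℝ), 0 < p → p ≤ q → q < 1 →
    pairSumR n q - pairSumR n p = ∫ s in p..q, mergeMomentPiv n s

/-- In-box VOLUME two-ghost with exponent `y`, summed over the edges of the box, uniform in the
parameter: `Σ_{e = uv} P_s(u ↮ v in B(n), |P_u| ≥ m, |P_v| ≥ m) ≤ C |B(n)| m^{-y}`.
(`y = 1/2`: Hutchcroft's two-ghost inequality adapted to the finite box; the card needs `y > 0.62`;
numerics `y ≈ 0.74`.) -/
def InBoxVolumeTwoGhost (y : ℝ) : Prop :=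
  ∃ C : ℝ, ∀ (t : ℝ) (n m : ℕ), 1 ≤ m →
    (∑ e ∈ edgesIn (zdGraph 3) (box 3 n),
      (μ (prm t)).real {ω | ∃ u ∈ box 3 n, ∃ v ∈ box 3 n, e = s(u, v) ∧
        ω ∉ openConnIn (↑(box 3 n) : Set (Site 3)) u v ∧
        m ≤ pieceSize (box 3 n) u ω ∧ m ≤ pieceSize (box 3 n) v ω}) ≤
      C * ((box 3 n).card : ℝ) * (m : ℝ) ^ (-y)

/-- (B1) merge-moment bound: `mergeMomentPiv n s ≤ C (1-s)⁻¹ n³ (n³)^{2-y}` (layer-cake over the two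
piece sizes, the two-ghost bound for the smaller one, pieces capped by `|B(n)| ≤ 27 n³`). -/
def MergeMomentBound (y : ℝ) : Prop :=
  ∃ C : ℝ, ∀ (s : ℝ) (n : ℕ), 0 < s → s < 1 → 1 ≤ n →
    mergeMomentPiv n s ≤ C / (1 - s) * (n : ℝ) ^ (3 : ℝ) * ((n : ℝ) ^ (3 : ℝ)) ^ (2 - y)

/-- (B1', provable from a two-ghost input) -/
def TwoGhostToMergeMoment : Prop :=
  ∀ y : ℝ, 1 / 2 ≤ y → y < 1 → InBoxVolumeTwoGhost y → MergeMomentBound y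

/-- (B2, open; strictly weaker than the crux, which is the case `b = ∞`) polynomially-subcritical
sparsity: at `p_c - n^{-b}` the free box is L²-sparse at rate `a`. Implied by any subcritical
correlation-length bound `ξ(p_c-δ) ≤ C δ^{-ν⁺}` with `b ν⁺ < 1` (Aizenman–Newman tail), or by
`χ(p_c-δ) ≤ C δ^{-γ⁺}` with `b γ⁺ ≤ 3 - a`. -/
def SubcriticalBoxSparsity (b a : ℝ) : Prop :=
  ∃ C : ℝ, ∀ n : ℕ, 1 ≤ n →
    FA2 n (prm ((criticalProbI 3 : ℝ) - (n : ℝ) ^ (-b))) ≤ C * (n : ℝ) ^ (-a)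

/-- First lemma of Card B (arithmetic closure; provable now given `p_c < 1`):
`E_{p_c} S_n = E_{p*} S_n + ∫_{p*}^{p_c} mergeMomentPiv ≤ C n^{6-a} + n^{-b} · C' n^{3+3(2-y)}`
and `9 - 3y - b < 6 - a`. -/
def CardB_closure : Prop :=
  ∀ y b a : ℝ, 0 < a → 1 / 2 ≤ y → y < 1 → 3 - 3 * y + a < b →
    FreeBoxRusso → MergeMomentBound y → SubcriticalBoxSparsity b a →
      Summit.CriticalPhenomena.PercolationContinuityZ3.Theses.PercNonProliferation.FreeBoxPowerSaving

/-! ## Shared bookkeeping (provable now): the BK square-root trick for the largest free piece -/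

/-- `q_n(m) = P_{p_c}(some piece of B(n) has ≥ m vertices)`. -/
noncomputable def fatProb (n m : ℕ) : ℝ :=
  μc.real {ω | ∃ x ∈ box 3 n, m ≤ pieceSize (box 3 n) x ω}

/-- BK submultiplicativity of the largest-piece tail: a piece with `≥ 3m` vertices contains two
edge-disjoint open trees with `≥ m` vertices each (`bk_finitary`). Consequences: median bounds are
moment bounds (`E|K_max| ≤ 4·median`), and `q_n(m) ≥ q_n(3^k m)^{2^{-k}}` (fat w.p. ½ ⇒ fat/3ᵏ w.h.p.). -/
def LargestPieceSqrtTrick : Prop :=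
  ∀ n m : ℕ, 1 ≤ m → fatProb n (3 * m) ≤ fatProb n m ^ 2

/-- The one-bit-per-scale form of the crux it yields (both directions elementary:
`FA₂ ≤ E|K_max|/|B|`, `E|K_max|² ≤ FA₂ |B|²`, Markov, and the trick). -/
def MedianFatForm : Prop :=
  Summit.CriticalPhenomena.PercolationContinuityZ3.Theses.PercNonProliferation.FreeBoxPowerSaving ↔
    ∃ a C : ℝ, 0 < a ∧ ∀ n : ℕ, 1 ≤ n → fatProb n ⌈C * (n : ℝ) ^ (3 - a)⌉₊ ≤ 1 / 2

end Summit.CriticalPhenomena.PercolationContinuityZ3.Cruxes.FreeBoxPowerSaving.Ideator3
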